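/-
Copyright: the b2b-balaban T⁴-continuum CRUX team, row NE7b OWNER lineage `t4-ne7b-p1` (gen 119). Project licence.
-/
import Summits.QuantumFields.BalabanUV.T4Continuum.Spine.NE7b.SupConvexStepIntegrated

/-!
# TWO INTEGRATED STEPS ARE ONE INTEGRATED STEP: integrating the fibres of `Q₁` along a chart `P₁` and then the fibres of `Q₂` along
# a chart `P₂` IS integrating the fibres of `Q₂∘Q₁` along the composite chart `P₁₂(z₂, z₁) = M₁(P₂ z₂) + P₁ z₁` on `σ₂ ⊕ σ₁`:
# `∫ e^{−W₁(M₂ w₂ + P₂ z₂)} dz₂ = ∫ e^{−S(M₁M₂ w₂ + P₁₂ z)} dz` with `W₁ = −log ∫ e^{−S(M₁ · + P₁ z₁)} dz₁` (Fubini on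
# `(σ₂ ⊕ σ₁ → ℝ) ≃ (σ₂ → ℝ) × (σ₁ → ℝ)`), and the composite block data `(Q₂∘Q₁, M₁∘M₂, vol₁·vol₂, P₁₂)` are again admissible
# (right inverse, block Jensen, `Q₁₂∘P₁₂ = 0`, injective, onto `ker(Q₂∘Q₁)`) — the measure-side twin of (110) §2's semigroup law
# (row NE7b, node U5c; (115) + (116) BY NAME; [folklore])

Cell `pub-balaban`, sub-cell `t4`, spine estimate NE7b (`T4WeightBudget.RelWeightBound`; the cell's OWN estimate — NOT PRINTED in
[Bałaban 1983–89], NOT PROVED).  Crux-route work under `Spine/NE7b/` by the row OWNER (`t4-ne7b-p1` gen 119) under FREEZE (0)'s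
crux-prover clause, on (116)'s own located «no semigroup law for the integrated step typed (Fubini along composite charts)»; NOTHING
of Bałaban's is named as a Lean object, valued or asserted; no `T4Continuum/Support` leaf typed; no `def`, no notation (the composite
chart is a displayed hypothesis `hP₁₂`, shown inhabited); zero `sorry`.  Imports (BY NAME): the OWNER's (116) `…SupConvexStepIntegrated`
(`integratedStep_firstOrder`; through it (115) `integrable_exp_neg_chart`, `fibreIntegral_pos`, `hasFDerivAt_neg_log_fibreIntegral_chart`,
(114) `continuous_of_hasFDerivAt`), Mathlib's Fubini (`integral_prod`) and `volume_measurePreserving_sumPiEquivProdPi_symm`.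

WHY (located).  (110) §2 proved `Φ₁ ∘ Φ₂ = Φ₁₂` for the minimising step; print's renormalisation group is a SEQUENCE of integrated
steps whose composite must again be a step of the same kind (this is what makes `k` steps one statement about `Q^{(k)}`).  On the
class this is Fubini: `e^{−W₁} = Z₁ > 0` turns the outer integrand into the inner fibre integral, the product Lebesgue measure on
`σ₂ ⊕ σ₁ → ℝ` is the product of the two, and the integrand is integrable on the product because its sections are (115)'s densities
and its section integrals are `e^{−W₁}` along the chart `P₂` — integrable by (115) applied to `W₁`, which is in the class by (115)∕(116).

WHAT IS PROVED ([folklore]; finite carriers `ι, κ, κ₂, σ₁, σ₂`):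
* §1 (composite block data) `sumPi_symm_apply`, `sum_sq_sum_type`, **`exists_compChart`** (the CLM `P₁₂ z = M₁(P₂(z∘inl)) + P₁(z∘inr)`
  exists), `compChart_ker` (`Q₂(Q₁(P₁₂ z)) = 0`), `comp_rightInverse` (`Q₂(Q₁(M₁(M₂ k))) = k`), `comp_blockJensen`
  (`vol₁vol₂·Σ(Q₂(Q₁ h))² ≤ Σ h²`), **`compChart_injective`** (`∃ p₁₂ > 0`, `p₁₂·Σ z² ≤ Σ(P₁₂ z)²`, from `p₁, p₂ > 0`, block Jensen
  `vol₁ > 0` and the ceilings `Σ(M₁ k)² ≤ μ₁Σ k²`, `Σ(P₂ z)² ≤ p₂′Σ z²`), `compChart_surjective` (onto `ker(Q₂∘Q₁)` if `P₁`, `P₂` are onto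
  `ker Q₁`, `ker Q₂`).
* §2 **`twoStep_fibreIntegral_eq`** (two-sided class, `m > 0`, `Λ ≥ 0`, `vol₁ > 0`, `p₁, p₂ > 0`: for every `w₂`,
  `∫ e^{−W₁(M₂ w₂ + P₂ z₂)} dz₂ = ∫ e^{−S(M₁(M₂ w₂) + P₁₂ z)} dz`), **`twoStep_eq`** (`W₂ = W₁₂` pointwise: TWO INTEGRATED BLOCK-SPIN
  STEPS ARE ONE with the composite block map and chart).
* §3 toy.

HONEST (what this is NOT).  Fubini and bookkeeping; two-sided class (the inner effective action must be differentiable for (115)'s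
integrability lemma to apply to it as stated); no normalisation of the measures (composite Jacobians are products — constants); no
locality; nothing about which block maps ∕ charts print uses; cubic periods; scalar skeleton, hard constraint ((A3), NC-NE7b-α
UNRULED); nothing of Bałaban's.  BY-NAME EFFECT ON THE WALL: NONE.  NE7b NOT PRINTED ∕ NOT PROVED; spine PROVED 0∕9; rung (B)+1 on a
FINITE torus — NOT infinite volume, NOT the mass gap, NOT Clay.  HONEST DEPENDENCY: continuum YM on T⁴ ⇐ BetaPertH ∧ nine spine
estimates (0∕9 proved); BetaPertH ⇐ (D1) ∧ (D4) ∧ CAP+tail; G-an2-4 gates asym, D1 and NE2∕3∕4.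
-/

set_option autoImplicit false

noncomputable section

namespace Summit.QuantumFields.BalabanUV.T4Continuum.NE7b.SupConvexStepIntegratedSemigroup

open Set Function Filter MeasureTheory Real
open scoped Topology
open SupConvexClassEnvelope (continuous_of_hasFDerivAt)
open SupConvexFibreIntegral (integrable_exp_neg_chart fibreIntegral_pos hasFDerivAt_neg_log_fibreIntegral_chart)
open SupConvexStepIntegrated (integratedStep_firstOrder)

/-! ## §1. Composite block data -/

section Data

variable {ι κ κ₂ σ₁ σ₂ : Type*} [Fintype ι] [Fintype κ] [Fintype κ₂] [Fintype σ₁] [Fintype σ₂]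
  (Q₁ : (ι → ℝ) →L[ℝ] (κ → ℝ)) (M₁ : (κ → ℝ) →L[ℝ] (ι → ℝ)) (P₁ : (σ₁ → ℝ) →L[ℝ] (ι → ℝ))
  (Q₂ : (κ → ℝ) →L[ℝ] (κ₂ → ℝ)) (M₂ : (κ₂ → ℝ) →L[ℝ] (κ → ℝ)) (P₂ : (σ₂ → ℝ) →L[ℝ] (κ → ℝ))
  (P₁₂ : ((σ₂ ⊕ σ₁) → ℝ) →L[ℝ] (ι → ℝ))

omit [Fintype σ₁] [Fintype σ₂] in
/-- The inverse of `sumPiEquivProdPi` glues the two coordinate blocks: it is `Sum.elim`. [folklore] -/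
theorem sumPi_symm_apply (q : (σ₂ → ℝ) × (σ₁ → ℝ)) :
    (MeasurableEquiv.sumPiEquivProdPi fun _ : σ₂ ⊕ σ₁ => ℝ).symm q = Sum.elim q.1 q.2 := by
  funext i
  cases i <;> rfl

/-- `Σ_{σ₂ ⊕ σ₁} z² = Σ_{σ₂} (z∘inl)² + Σ_{σ₁} (z∘inr)²`. [folklore] -/
theorem sum_sq_sum_type (z : (σ₂ ⊕ σ₁) → ℝ) :
    ∑ i, z i ^ 2 = ∑ j, z (Sum.inl j) ^ 2 + ∑ j, z (Sum.inr j) ^ 2 :=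
  Fintype.sum_sum_type _

omit [Fintype ι] [Fintype κ] [Fintype σ₁] [Fintype σ₂] in
/-- **THE COMPOSITE CHART EXISTS** as a continuous linear map: `P₁₂ z = M₁(P₂(z∘inl)) + P₁(z∘inr)`. [folklore] -/
theorem exists_compChart : ∃ P : ((σ₂ ⊕ σ₁) → ℝ) →L[ℝ] (ι → ℝ),
    ∀ z, P z = M₁ (P₂ fun j => z (Sum.inl j)) + P₁ fun j => z (Sum.inr j) := by
  let R₂ : ((σ₂ ⊕ σ₁) → ℝ) →L[ℝ] (σ₂ → ℝ) :=
    ContinuousLinearMap.pi fun j => ContinuousLinearMap.proj (R := ℝ) (φ := fun _ : σ₂ ⊕ σ₁ => ℝ) (Sum.inl j)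
  let R₁ : ((σ₂ ⊕ σ₁) → ℝ) →L[ℝ] (σ₁ → ℝ) :=
    ContinuousLinearMap.pi fun j => ContinuousLinearMap.proj (R := ℝ) (φ := fun _ : σ₂ ⊕ σ₁ => ℝ) (Sum.inr j)
  refine ⟨(M₁.comp (P₂.comp R₂)) + P₁.comp R₁, fun z => ?_⟩
  rfl

omit [Fintype ι] [Fintype κ] [Fintype κ₂] [Fintype σ₁] [Fintype σ₂] in
/-- **THE COMPOSITE CHART LIES IN `ker(Q₂∘Q₁)`** (`Q₁∘M₁ = 1`, `Q₁∘P₁ = 0`, `Q₂∘P₂ = 0`). [folklore] -/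
theorem compChart_ker (hQM₁ : ∀ k : κ → ℝ, Q₁ (M₁ k) = k) (hQP₁ : ∀ z : σ₁ → ℝ, Q₁ (P₁ z) = 0)
    (hQP₂ : ∀ z : σ₂ → ℝ, Q₂ (P₂ z) = 0)
    (hP₁₂ : ∀ z, P₁₂ z = M₁ (P₂ fun j => z (Sum.inl j)) + P₁ fun j => z (Sum.inr j)) (z : (σ₂ ⊕ σ₁) → ℝ) :
    (Q₂.comp Q₁) (P₁₂ z) = 0 := by
  rw [ContinuousLinearMap.comp_apply, hP₁₂, map_add, hQM₁, hQP₁, add_zero, hQP₂]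

omit [Fintype ι] [Fintype κ] [Fintype κ₂] [Fintype σ₁] [Fintype σ₂] in
/-- `M₁∘M₂` is a right inverse of `Q₂∘Q₁`. [folklore] -/
theorem comp_rightInverse (hQM₁ : ∀ k : κ → ℝ, Q₁ (M₁ k) = k) (hQM₂ : ∀ k : κ₂ → ℝ, Q₂ (M₂ k) = k) (k : κ₂ → ℝ) :
    (Q₂.comp Q₁) ((M₁.comp M₂) k) = k := by
  simp only [ContinuousLinearMap.comp_apply, hQM₁, hQM₂]

omit [Fintype σ₁] [Fintype σ₂] in
/-- **BLOCK JENSEN COMPOSES**: `vol₁·Σ(Q₁ h)² ≤ Σ h²`, `vol₂·Σ(Q₂ k)² ≤ Σ k²`, `vol₁ ≥ 0` ⟹ `vol₁vol₂·Σ(Q₂(Q₁ h))² ≤ Σ h²`. [folklore] -/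
theorem comp_blockJensen {vol₁ vol₂ : ℝ} (hvol₁ : 0 ≤ vol₁) (hJ₁ : ∀ h : ι → ℝ, vol₁ * ∑ y, Q₁ h y ^ 2 ≤ ∑ x, h x ^ 2)
    (hJ₂ : ∀ k : κ → ℝ, vol₂ * ∑ y, Q₂ k y ^ 2 ≤ ∑ x, k x ^ 2) (h : ι → ℝ) :
    vol₁ * vol₂ * ∑ y, (Q₂.comp Q₁) h y ^ 2 ≤ ∑ x, h x ^ 2 := by
  have h2 := mul_le_mul_of_nonneg_left (hJ₂ (Q₁ h)) hvol₁
  have h1 := hJ₁ h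
  simp only [ContinuousLinearMap.comp_apply]
  linarith

omit [Fintype κ₂] in
/-- **THE COMPOSITE CHART IS INJECTIVE, QUANTITATIVELY**: `p₁·Σ z₁² ≤ Σ(P₁ z₁)²`, `p₂·Σ z₂² ≤ Σ(P₂ z₂)² ≤ p₂′·Σ z₂²`,
`Σ(M₁ k)² ≤ μ₁·Σ k²`, block Jensen `vol₁·Σ(Q₁ h)² ≤ Σ h²` with `Q₁∘M₁ = 1`, `Q₁∘P₁ = 0`, and `p₁, p₂, vol₁ > 0`, `μ₁, p₂′ ≥ 0` ⟹
`∃ p₁₂ > 0`, `p₁₂·Σ z² ≤ Σ(P₁₂ z)²` for all `z`. [folklore] -/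
theorem compChart_injective {p₁ p₂ p₂' μ₁ vol₁ : ℝ} (hp₁ : 0 < p₁) (hp₂ : 0 < p₂) (hp₂' : 0 ≤ p₂') (hμ₁ : 0 ≤ μ₁)
    (hvol₁ : 0 < vol₁) (hQM₁ : ∀ k : κ → ℝ, Q₁ (M₁ k) = k) (hQP₁ : ∀ z : σ₁ → ℝ, Q₁ (P₁ z) = 0)
    (hJ₁ : ∀ h : ι → ℝ, vol₁ * ∑ y, Q₁ h y ^ 2 ≤ ∑ x, h x ^ 2)
    (hP₁ : ∀ z : σ₁ → ℝ, p₁ * ∑ i, z i ^ 2 ≤ ∑ x, P₁ z x ^ 2)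
    (hP₂ : ∀ z : σ₂ → ℝ, p₂ * ∑ i, z i ^ 2 ≤ ∑ y, P₂ z y ^ 2) (hP₂' : ∀ z : σ₂ → ℝ, ∑ y, P₂ z y ^ 2 ≤ p₂' * ∑ i, z i ^ 2)
    (hμM₁ : ∀ k : κ → ℝ, ∑ x, M₁ k x ^ 2 ≤ μ₁ * ∑ y, k y ^ 2)
    (hP₁₂ : ∀ z, P₁₂ z = M₁ (P₂ fun j => z (Sum.inl j)) + P₁ fun j => z (Sum.inr j)) :
    ∃ p₁₂ : ℝ, 0 < p₁₂ ∧ ∀ z : (σ₂ ⊕ σ₁) → ℝ, p₁₂ * ∑ i, z i ^ 2 ≤ ∑ x, P₁₂ z x ^ 2 := by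
  -- the weight `t ∈ (0,1)` balancing the two lower bounds
  set D : ℝ := vol₁ * p₂ + μ₁ * p₂' with hD
  have hDpos : 0 < D := by positivity
  set t : ℝ := vol₁ * p₂ / (2 * D) with ht
  have ht0 : 0 < t := by positivity
  have ht1 : t ≤ 1 / 2 := by
    rw [ht, div_le_div_iff₀ (by positivity) (by norm_num : (0 : ℝ) < 2)]
    nlinarith [mul_nonneg hμ₁ hp₂']
  refine ⟨min (t * (p₁ / 2)) (vol₁ * p₂ / 2), lt_min (by positivity) (by positivity), fun z => ?_⟩
  set z₂ : σ₂ → ℝ := fun j => z (Sum.inl j)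
  set z₁ : σ₁ → ℝ := fun j => z (Sum.inr j)
  set A : ℝ := ∑ x, P₁₂ z x ^ 2 with hA
  -- bound 1: block Jensen on `Q₁`
  have hb1 : vol₁ * p₂ * ∑ j, z₂ j ^ 2 ≤ A := by
    have hJ := hJ₁ (P₁₂ z)
    have hQ : Q₁ (P₁₂ z) = P₂ z₂ := by rw [hP₁₂, map_add, hQM₁, hQP₁, add_zero]
    rw [hQ] at hJ
    have := mul_le_mul_of_nonneg_left (hP₂ z₂) hvol₁.le
    rw [hA]; linarith
  -- bound 2: `(u + v)² ≥ ½v² − u²`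
  have hb2 : p₁ / 2 * ∑ j, z₁ j ^ 2 - μ₁ * p₂' * ∑ j, z₂ j ^ 2 ≤ A := by
    have hpt : ∀ x, (P₁ z₁ x) ^ 2 / 2 - (M₁ (P₂ z₂) x) ^ 2 ≤ (P₁₂ z x) ^ 2 := fun x => by
      rw [hP₁₂, Pi.add_apply]
      nlinarith [sq_nonneg (P₁ z₁ x / 2 + M₁ (P₂ z₂) x), sq_nonneg (P₁ z₁ x + 2 * M₁ (P₂ z₂) x)]
    have hsum := Finset.sum_le_sum fun x (_ : x ∈ Finset.univ) => hpt x
    rw [Finset.sum_sub_distrib, ← Finset.sum_div] at hsum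
    have hM := (hμM₁ (P₂ z₂)).trans (mul_le_mul_of_nonneg_left (hP₂' z₂) hμ₁)
    have h1 := hP₁ z₁
    rw [hA]; nlinarith
  -- combine with weights `t` and `1 − t`
  have hsplit : ∑ i, z i ^ 2 = ∑ j, z₂ j ^ 2 + ∑ j, z₁ j ^ 2 := sum_sq_sum_type z
  have hS2 : 0 ≤ ∑ j, z₂ j ^ 2 := Finset.sum_nonneg fun j _ => sq_nonneg _
  have hS1 : 0 ≤ ∑ j, z₁ j ^ 2 := Finset.sum_nonneg fun j _ => sq_nonneg _
  have hcomb : t * (p₁ / 2) * ∑ j, z₁ j ^ 2 + ((1 - t) * (vol₁ * p₂) - t * (μ₁ * p₂')) * ∑ j, z₂ j ^ 2 ≤ A := by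
    have k1 := mul_le_mul_of_nonneg_left hb2 ht0.le
    have k2 := mul_le_mul_of_nonneg_left hb1 (by linarith : 0 ≤ 1 - t)
    nlinarith
  have hcoef : vol₁ * p₂ / 2 = (1 - t) * (vol₁ * p₂) - t * (μ₁ * p₂') := by
    rw [ht, hD]; field_simp; ring
  have hmin1 : min (t * (p₁ / 2)) (vol₁ * p₂ / 2) ≤ t * (p₁ / 2) := min_le_left _ _
  have hmin2 : min (t * (p₁ / 2)) (vol₁ * p₂ / 2) ≤ vol₁ * p₂ / 2 := min_le_right _ _
  rw [hsplit, mul_add]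
  calc min (t * (p₁ / 2)) (vol₁ * p₂ / 2) * ∑ j, z₂ j ^ 2 + min (t * (p₁ / 2)) (vol₁ * p₂ / 2) * ∑ j, z₁ j ^ 2
      ≤ vol₁ * p₂ / 2 * ∑ j, z₂ j ^ 2 + t * (p₁ / 2) * ∑ j, z₁ j ^ 2 :=
        add_le_add (mul_le_mul_of_nonneg_right hmin2 hS2) (mul_le_mul_of_nonneg_right hmin1 hS1)
    _ ≤ A := by rw [hcoef]; linarith

omit [Fintype ι] [Fintype κ] [Fintype κ₂] [Fintype σ₁] [Fintype σ₂] in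
/-- **THE COMPOSITE CHART IS ONTO `ker(Q₂∘Q₁)`** if `P₁` is onto `ker Q₁` and `P₂` onto `ker Q₂` (`Q₁∘M₁ = 1`). [folklore] -/
theorem compChart_surjective (hQM₁ : ∀ k : κ → ℝ, Q₁ (M₁ k) = k)
    (hP₁s : ∀ h : ι → ℝ, Q₁ h = 0 → ∃ z : σ₁ → ℝ, P₁ z = h) (hP₂s : ∀ k : κ → ℝ, Q₂ k = 0 → ∃ z : σ₂ → ℝ, P₂ z = k)
    (hP₁₂ : ∀ z, P₁₂ z = M₁ (P₂ fun j => z (Sum.inl j)) + P₁ fun j => z (Sum.inr j)) (h : ι → ℝ)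
    (hh : (Q₂.comp Q₁) h = 0) : ∃ z : (σ₂ ⊕ σ₁) → ℝ, P₁₂ z = h := by
  obtain ⟨z₂, hz₂⟩ := hP₂s (Q₁ h) (by simpa only [ContinuousLinearMap.comp_apply] using hh)
  obtain ⟨z₁, hz₁⟩ := hP₁s (h - M₁ (Q₁ h)) (by rw [map_sub, hQM₁, sub_self])
  refine ⟨Sum.elim z₂ z₁, ?_⟩
  rw [hP₁₂]
  simp only [Sum.elim_inl, Sum.elim_inr]
  rw [show (fun j => z₂ j) = z₂ from rfl, show (fun j => z₁ j) = z₁ from rfl, hz₂, hz₁]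
  abel

end Data

/-! ## §2. Two integrated steps are one integrated step -/

section Semigroup

variable {ι κ κ₂ σ₁ σ₂ : Type*} [Fintype ι] [Fintype κ] [Fintype κ₂] [Fintype σ₁] [Fintype σ₂]
  {S : (ι → ℝ) → ℝ} {S' : (ι → ℝ) → (ι → ℝ) →L[ℝ] ℝ} {m Λ vol₁ p₁ p₂ : ℝ}
  (Q₁ : (ι → ℝ) →L[ℝ] (κ → ℝ)) (M₁ : (κ → ℝ) →L[ℝ] (ι → ℝ)) (P₁ : (σ₁ → ℝ) →L[ℝ] (ι → ℝ))
  (M₂ : (κ₂ → ℝ) →L[ℝ] (κ → ℝ)) (P₂ : (σ₂ → ℝ) →L[ℝ] (κ → ℝ)) (P₁₂ : ((σ₂ ⊕ σ₁) → ℝ) →L[ℝ] (ι → ℝ))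

omit [Fintype κ₂] in
/-- **THE SEMIGROUP IDENTITY FOR THE INTEGRATED STEP** (two-sided class `m > 0`, `Λ ≥ 0`; `Q₁∘M₁ = 1`, `Q₁∘P₁ = 0`, block Jensen
`vol₁ > 0`; charts `p₁, p₂ > 0`; `P₁₂` the composite chart): with `W₁(w) = −log ∫ e^{−S(M₁ w + P₁ z₁)} dz₁`, for every `w₂`,
`∫ e^{−W₁(M₂ w₂ + P₂ z₂)} dz₂ = ∫ e^{−S(M₁(M₂ w₂) + P₁₂ z)} dz` — the outer step's fibre integral of the inner effective action IS the
fibre integral of the original action along the composite chart. [folklore] -/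
theorem twoStep_fibreIntegral_eq (hS : ∀ φ, HasFDerivAt S (S' φ) φ)
    (hlo : ∀ φ ψ : ι → ℝ, S φ + S' φ (ψ - φ) + m / 2 * ∑ x, (ψ x - φ x) ^ 2 ≤ S ψ) (hm : 0 < m)
    (hup : ∀ φ ψ : ι → ℝ, S ψ ≤ S φ + S' φ (ψ - φ) + Λ / 2 * ∑ x, (ψ x - φ x) ^ 2) (hΛ : 0 ≤ Λ)
    (hQM₁ : ∀ k : κ → ℝ, Q₁ (M₁ k) = k) (hQP₁ : ∀ z : σ₁ → ℝ, Q₁ (P₁ z) = 0) (hvol₁ : 0 < vol₁)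
    (hJ₁ : ∀ h : ι → ℝ, vol₁ * ∑ y, Q₁ h y ^ 2 ≤ ∑ x, h x ^ 2)
    (hP₁ : ∀ z : σ₁ → ℝ, p₁ * ∑ i, z i ^ 2 ≤ ∑ x, P₁ z x ^ 2) (hp₁ : 0 < p₁)
    (hP₂ : ∀ z : σ₂ → ℝ, p₂ * ∑ i, z i ^ 2 ≤ ∑ y, P₂ z y ^ 2) (hp₂ : 0 < p₂)
    (hP₁₂ : ∀ z, P₁₂ z = M₁ (P₂ fun j => z (Sum.inl j)) + P₁ fun j => z (Sum.inr j)) (w₂ : κ₂ → ℝ) :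
    ∫ z₂ : σ₂ → ℝ, exp (-(-log (∫ z₁ : σ₁ → ℝ, exp (-S (M₁ (M₂ w₂ + P₂ z₂) + P₁ z₁))))) =
      ∫ z : (σ₂ ⊕ σ₁) → ℝ, exp (-S (M₁ (M₂ w₂) + P₁₂ z)) := by
  have hcont : Continuous S := continuous_of_hasFDerivAt hS
  -- the inner effective action `W₁` is in the class (two-sided ⟹ differentiable, lower letter `m·vol₁`)
  set W₁ : (κ → ℝ) → ℝ := fun w => -log (∫ z₁ : σ₁ → ℝ, exp (-S (M₁ w + P₁ z₁))) with hW₁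
  set W₁' : (κ → ℝ) → (κ → ℝ) →L[ℝ] ℝ := fun w =>
    (∫ z₁ : σ₁ → ℝ, exp (-S (M₁ w + P₁ z₁)))⁻¹ • ∫ z₁ : σ₁ → ℝ, exp (-S (M₁ w + P₁ z₁)) • (S' (M₁ w + P₁ z₁)).comp M₁
    with hW₁'
  have hW₁d : ∀ w, HasFDerivAt W₁ (W₁' w) w := fun w =>
    hasFDerivAt_neg_log_fibreIntegral_chart M₁ P₁ hS hlo hm hup hΛ hP₁ hp₁ w
  have hW₁lo : ∀ w w' : κ → ℝ, W₁ w + W₁' w (w' - w) + m * vol₁ / 2 * ∑ y, (w' y - w y) ^ 2 ≤ W₁ w' := fun w w' =>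
    integratedStep_firstOrder Q₁ M₁ P₁ hS hlo hm hup hΛ hQM₁ hQP₁ hJ₁ hP₁ hp₁ w w'
  -- the outer integrand is the inner fibre integral
  have hZ₁ : ∀ w, 0 < ∫ z₁ : σ₁ → ℝ, exp (-S (M₁ w + P₁ z₁)) := fun w => fibreIntegral_pos M₁ P₁ hS hlo hm hP₁ hp₁ w
  have hexp : ∀ z₂ : σ₂ → ℝ, exp (-(-log (∫ z₁ : σ₁ → ℝ, exp (-S (M₁ (M₂ w₂ + P₂ z₂) + P₁ z₁))))) =
      ∫ z₁ : σ₁ → ℝ, exp (-S (M₁ (M₂ w₂ + P₂ z₂) + P₁ z₁)) := fun z₂ => by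
    rw [neg_neg, exp_log (hZ₁ _)]
  simp_rw [hexp]
  -- the joint integrand on the product and its integrability
  set F : (σ₂ → ℝ) × (σ₁ → ℝ) → ℝ := fun q => exp (-S (M₁ (M₂ w₂ + P₂ q.1) + P₁ q.2)) with hF
  have hFc : Continuous F := continuous_exp.comp (hcont.comp
    (((continuous_const (y := M₂ w₂)).add (P₂.continuous.comp continuous_fst) |> M₁.continuous.comp).add
      (P₁.continuous.comp continuous_snd))).neg
  have hFint : Integrable F ((volume : Measure (σ₂ → ℝ)).prod (volume : Measure (σ₁ → ℝ))) := by
    refine (integrable_prod_iff hFc.aestronglyMeasurable).2 ⟨Eventually.of_forall fun z₂ => ?_, ?_⟩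
    · exact integrable_exp_neg_chart M₁ P₁ hS hlo hm hP₁ hp₁ (M₂ w₂ + P₂ z₂)
    · have hnorm : (fun z₂ : σ₂ → ℝ => ∫ z₁ : σ₁ → ℝ, ‖F (z₂, z₁)‖) = fun z₂ => exp (-W₁ (M₂ w₂ + P₂ z₂)) := by
        funext z₂
        rw [hW₁]
        simp only [hF, Real.norm_eq_abs, abs_of_pos (exp_pos _)]
        rw [neg_neg, exp_log (hZ₁ _)]
      rw [hnorm]
      exact integrable_exp_neg_chart M₂ P₂ hW₁d hW₁lo (mul_pos hm hvol₁) hP₂ hp₂ w₂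
  -- Fubini on the product, then transport to `σ₂ ⊕ σ₁ → ℝ`
  have hprod : ∫ z₂ : σ₂ → ℝ, ∫ z₁ : σ₁ → ℝ, exp (-S (M₁ (M₂ w₂ + P₂ z₂) + P₁ z₁)) =
      ∫ q : (σ₂ → ℝ) × (σ₁ → ℝ), F q ∂((volume : Measure (σ₂ → ℝ)).prod (volume : Measure (σ₁ → ℝ))) :=
    (integral_prod F hFint).symm
  rw [hprod, ← Measure.volume_eq_prod]
  have hmp := volume_measurePreserving_sumPiEquivProdPi_symm (fun _ : σ₂ ⊕ σ₁ => ℝ)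
  rw [← hmp.integral_comp']
  refine integral_congr_ae (Eventually.of_forall fun q => ?_)
  simp only [hF, sumPi_symm_apply, hP₁₂, Sum.elim_inl, Sum.elim_inr, map_add, add_assoc]

omit [Fintype κ₂] in
/-- **TWO INTEGRATED BLOCK-SPIN STEPS ARE ONE**: under the hypotheses of `twoStep_fibreIntegral_eq`, the twice-integrated effective
action `W₂(w₂) = −log ∫ e^{−W₁(M₂ w₂ + P₂ z₂)} dz₂` EQUALS the once-integrated effective action of the composite step
`W₁₂(w₂) = −log ∫ e^{−S((M₁∘M₂) w₂ + P₁₂ z)} dz` at every `w₂` — with §1 the composite data `(Q₂∘Q₁, M₁∘M₂, vol₁vol₂, P₁₂)` are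
admissible, so (115)–(117) apply to `W₂` directly as ONE step. [folklore] -/
theorem twoStep_eq (hS : ∀ φ, HasFDerivAt S (S' φ) φ)
    (hlo : ∀ φ ψ : ι → ℝ, S φ + S' φ (ψ - φ) + m / 2 * ∑ x, (ψ x - φ x) ^ 2 ≤ S ψ) (hm : 0 < m)
    (hup : ∀ φ ψ : ι → ℝ, S ψ ≤ S φ + S' φ (ψ - φ) + Λ / 2 * ∑ x, (ψ x - φ x) ^ 2) (hΛ : 0 ≤ Λ)
    (hQM₁ : ∀ k : κ → ℝ, Q₁ (M₁ k) = k) (hQP₁ : ∀ z : σ₁ → ℝ, Q₁ (P₁ z) = 0) (hvol₁ : 0 < vol₁)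
    (hJ₁ : ∀ h : ι → ℝ, vol₁ * ∑ y, Q₁ h y ^ 2 ≤ ∑ x, h x ^ 2)
    (hP₁ : ∀ z : σ₁ → ℝ, p₁ * ∑ i, z i ^ 2 ≤ ∑ x, P₁ z x ^ 2) (hp₁ : 0 < p₁)
    (hP₂ : ∀ z : σ₂ → ℝ, p₂ * ∑ i, z i ^ 2 ≤ ∑ y, P₂ z y ^ 2) (hp₂ : 0 < p₂)
    (hP₁₂ : ∀ z, P₁₂ z = M₁ (P₂ fun j => z (Sum.inl j)) + P₁ fun j => z (Sum.inr j)) (w₂ : κ₂ → ℝ) :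
    -log (∫ z₂ : σ₂ → ℝ, exp (-(-log (∫ z₁ : σ₁ → ℝ, exp (-S (M₁ (M₂ w₂ + P₂ z₂) + P₁ z₁)))))) =
      -log (∫ z : (σ₂ ⊕ σ₁) → ℝ, exp (-S ((M₁.comp M₂) w₂ + P₁₂ z))) := by
  rw [twoStep_fibreIntegral_eq Q₁ M₁ P₁ M₂ P₂ P₁₂ hS hlo hm hup hΛ hQM₁ hQP₁ hvol₁ hJ₁ hP₁ hp₁ hP₂ hp₂ hP₁₂ w₂,
    ContinuousLinearMap.comp_apply]

end Semigroup

/-! ## §3. Toy -/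

/-- Toy (§1 `comp_rightInverse` with all maps the identity on one site). -/
example (k : Unit → ℝ) :
    ((ContinuousLinearMap.id ℝ (Unit → ℝ)).comp (ContinuousLinearMap.id ℝ (Unit → ℝ)))
      (((ContinuousLinearMap.id ℝ (Unit → ℝ)).comp (ContinuousLinearMap.id ℝ (Unit → ℝ))) k) = k :=
  comp_rightInverse (ContinuousLinearMap.id ℝ (Unit → ℝ)) (ContinuousLinearMap.id ℝ (Unit → ℝ))
    (ContinuousLinearMap.id ℝ (Unit → ℝ)) (ContinuousLinearMap.id ℝ (Unit → ℝ)) (fun _ => rfl) (fun _ => rfl) k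

end Summit.QuantumFields.BalabanUV.T4Continuum.NE7b.SupConvexStepIntegratedSemigroup

end
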